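import Summits.Ventures.PercRepro.RankLevelSetRuleQSliceBinom

/-!
# PercRepro — THE DENSITY COMPARISON: ON THE BOTTOM REGIME THE BORDERLINE FOLLOWS FROM `T ≤ 1` (night-1, gen 20; dossier §31.12)

With `ρ(n, r) = Σ_{s ≤ r} Π_{t<s} (r − t)/(n − r + 1 + t)` (`rho_as_prod_sum`, from the downward ratios `choose_down_ratio`), the
two partial-row ratios of the borderline identity `L − Φ = 1 + ρ(2q+k, q) − ρ(2q−k+2, q−k+2) − T` compare TERMWISE on the bottom
regime: with `k = k' + 2`, `q = m + k'`, every factor `(q − t)/(q + k + 1 + t)` of the first dominates the factor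
`(m − t)/(m + k' + 1 + t)` of the second as soon as `2m ≤ k'(k'+1)` (the difference of the cross products is
`k'² + k' − 2m + t(2k'+2)`), and the first sum has more terms. Hence
* **`rho_density_ge (m k') (2m ≤ k'(k'+1)) : ρ(2m+k', m) ≤ ρ(2m+3k'+2, m+k')`**, so `L − Φ ≥ 1 − T` there, and
* **`phiK_le_rhat_border_of_tail_le_one (m k') (2m ≤ k'(k'+1)) (T ≤ 1) : Φ(q+k, q) ≤ R̂(q, k, q−k+2)`**.
The bottom regime `k − 2 ≤ q < k(k−3)/2` is `m < (k−1)(k−4)/2 < k'(k'+1)/2`, so on ALL of it the conjecture of record reduces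
to the single tail bound `T(q, k) ≤ 1` — numerically `T ≤ 0.85` for `m ≥ 3` (the cells `m = 1, 2` are the lane's §23.8′ and
RankLevelSetRuleQSliceBorderFlatTwo). Axioms: standard.
-/

namespace PercRepro

open Finset

/-- `C(n, r − s)/C(n, r) = Π_{t<s} (r − t)/(n − r + 1 + t)` for `s ≤ r ≤ n` (telescoping `C(n, j)(n − j) = C(n, j+1)(j+1)`),
stated multiplicatively. -/
lemma choose_down_ratio (n r : ℕ) (hr : r ≤ n) : ∀ s : ℕ, s ≤ r →
    (n.choose (r - s) : ℚ) = (n.choose r : ℚ) * ∏ t ∈ range s, (((r : ℚ) - t) / ((n : ℚ) - r + 1 + t)) := by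
  intro s
  induction s with
  | zero => intro _; simp
  | succ s ih =>
    intro hs
    rw [Finset.prod_range_succ, ← mul_assoc, ← ih (by omega)]
    -- C(n, r−s−1) = C(n, r−s) · (r−s)/(n−r+s+1)
    have h := Nat.choose_succ_right_eq n (r - s - 1)      -- C(n, j+1)(j+1) = C(n, j)(n − j)
    rw [show r - s - 1 + 1 = r - s by omega, show n - (r - s - 1) = n - r + s + 1 by omega] at h
    have hc := congrArg (fun x : ℕ => (x : ℚ)) h
    push_cast [Nat.cast_sub (by omega : s ≤ r), Nat.cast_sub (by omega : r ≤ n), Nat.cast_sub (by omega : s + 1 ≤ r)] at hc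
    have hpos : (0 : ℚ) < (n : ℚ) - r + s + 1 := by
      have : (r : ℚ) ≤ n := by exact_mod_cast hr
      linarith
    rw [show r - (s + 1) = r - s - 1 by omega]
    have hpos' : (n : ℚ) - r + 1 + s ≠ 0 := by linarith
    rw [mul_div_assoc', eq_div_iff hpos']
    linarith [hc]


/-- `ρ(n, r) = Σ_{s ≤ r} Π_{t<s} (r − t)/(n − r + 1 + t)` (`r ≤ n`). -/
lemma rho_as_prod_sum (n r : ℕ) (hr : r ≤ n) :
    (∑ i ∈ range (r + 1), (n.choose i : ℚ)) / (n.choose r : ℚ)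
      = ∑ s ∈ range (r + 1), ∏ t ∈ range s, (((r : ℚ) - t) / ((n : ℚ) - r + 1 + t)) := by
  have hC : (0 : ℚ) < (n.choose r : ℚ) := Nat.cast_pos.mpr (Nat.choose_pos hr)
  rw [div_eq_iff hC.ne', Finset.sum_mul]
  rw [← Finset.sum_range_reflect (fun i => (n.choose i : ℚ)) (r + 1)]
  refine Finset.sum_congr rfl (fun s hs => ?_)
  rw [Finset.mem_range] at hs
  rw [show r + 1 - 1 - s = r - s by omega, choose_down_ratio n r hr s (by omega)]
  ring

/-- **THE DENSITY COMPARISON (A)**: on the borderline (`k = k' + 2`, `q = m + k'`) with `2m ≤ k'(k'+1)`,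
`ρ(2q+k, q) ≥ ρ(2m+k', m)` — termwise, every factor `(q − t)/(q + k + 1 + t)` dominates `(m − t)/(m + k' + 1 + t)`. -/
theorem rho_density_ge (m k' : ℕ) (h : 2 * m ≤ k' * (k' + 1)) :
    (∑ i ∈ range (m + 1), ((2 * m + k').choose i : ℚ)) / ((2 * m + k').choose m : ℚ)
      ≤ (∑ i ∈ range (m + k' + 1), ((2 * m + 3 * k' + 2).choose i : ℚ)) / ((2 * m + 3 * k' + 2).choose (m + k') : ℚ) := by
  rw [rho_as_prod_sum (2 * m + k') m (by omega), rho_as_prod_sum (2 * m + 3 * k' + 2) (m + k') (by omega)]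
  have hk : (0 : ℚ) ≤ k' := by positivity
  have hm0 : (0 : ℚ) ≤ m := by positivity
  have hcond : 2 * (m : ℚ) ≤ (k' : ℚ) * ((k' : ℚ) + 1) := by exact_mod_cast h
  -- termwise on s ≤ m, then the extra terms are nonnegative
  have hterm : ∀ s ∈ range (m + 1),
      ∏ t ∈ range s, (((m : ℚ) - t) / (((2 * m + k' : ℕ) : ℚ) - m + 1 + t))
        ≤ ∏ t ∈ range s, ((((m + k' : ℕ) : ℚ) - t) / (((2 * m + 3 * k' + 2 : ℕ) : ℚ) - ((m + k' : ℕ) : ℚ) + 1 + t)) := by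
    intro s hs
    rw [Finset.mem_range] at hs
    apply Finset.prod_le_prod
    · intro t ht
      rw [Finset.mem_range] at ht
      have ht0 : (0 : ℚ) ≤ t := by positivity
      apply div_nonneg
      · have : (t : ℚ) ≤ m := by exact_mod_cast (by omega : t ≤ m)
        linarith
      · push_cast; linarith
    · intro t ht
      rw [Finset.mem_range] at ht
      have ht' : (t : ℚ) ≤ m := by exact_mod_cast (by omega : t ≤ m)
      have ht0 : (0 : ℚ) ≤ t := by positivity
      push_cast
      rw [div_le_div_iff₀ (by linarith) (by linarith)]
      nlinarith [hcond, ht0, hk, mul_nonneg ht0 hk]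
  calc ∑ s ∈ range (m + 1), ∏ t ∈ range s, (((m : ℚ) - t) / (((2 * m + k' : ℕ) : ℚ) - m + 1 + t))
      ≤ ∑ s ∈ range (m + 1), ∏ t ∈ range s, ((((m + k' : ℕ) : ℚ) - t) / (((2 * m + 3 * k' + 2 : ℕ) : ℚ) - ((m + k' : ℕ) : ℚ) + 1 + t)) :=
        Finset.sum_le_sum hterm
    _ ≤ ∑ s ∈ range (m + k' + 1), ∏ t ∈ range s, ((((m + k' : ℕ) : ℚ) - t) / (((2 * m + 3 * k' + 2 : ℕ) : ℚ) - ((m + k' : ℕ) : ℚ) + 1 + t)) := by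
        apply Finset.sum_le_sum_of_subset_of_nonneg (Finset.range_mono (by omega))
        intro s hs _
        rw [Finset.mem_range] at hs
        apply Finset.prod_nonneg
        intro t ht
        rw [Finset.mem_range] at ht
        have ht0 : (0 : ℚ) ≤ t := by positivity
        apply div_nonneg
        · push_cast
          have : (t : ℚ) ≤ (m : ℚ) + k' := by exact_mod_cast (by omega : t ≤ m + k')
          linarith
        · push_cast; linarith


/-- **THE BOTTOM REGIME FROM `T ≤ 1`**: on `2m ≤ k'(k'+1)` (`k = k' + 2`, `q = m + k'`), if the tail of the borderline identity is
at most `1` then `Φ(q+k, q) ≤ R̂(q, k, q − k + 2)`. -/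
theorem phiK_le_rhat_border_of_tail_le_one (m k' : ℕ) (h : 2 * m ≤ k' * (k' + 1))
    (hT : ∑ j ∈ range (k' + 1), ((2 * k' + 2).choose (k' + 2 + j) : ℚ)
        * ∑ a ∈ range (m + 1), (m.choose a : ℚ) / ((m + k' + (k' + 2 + j) + a).choose (a + (k' + 2 + j)) : ℚ) ≤ 1) :
    phiK (m + k' + (k' + 2)) (m + k') ≤ rhat (m + k') (k' + 2) m := by
  refine phiK_le_rhat_border_of_rho m k' ?_
  have := rho_density_ge m k' h
  linarith [this, hT]

end PercRepro
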